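/-
Copyright (c) 2026 the pub-hodgecm-mathlib formalisation cell (harness21).  Prover seat hodgecm-mathlib-R90-C10-p05 (g2), R90-TF SLAB section S1 «Ch10-local» (base
R90-C10), h413 = `stmt-HodgeConjecture-24833`; line «B_pos» (U4Keys :182 in BRANCH B at positive depth, memo `R90/R90-C10-p05/g2/DESIGN-Bpos-inert.md`, RULING R-S1-12
(3) of the S1 chair R90-C10-plan (g2)): brick (B-2b′), CM half — «THE CELL LETTERS `hcells` AND `hwit` OF THE BRANCH-B ENGINE AT THE TWO-DEPTH GROUP `J_e` ON
`U(Φ₃)(L⁺_v)`»: the three-way cover transported along `eA`, and the shell witnesses of ★ p862990 in the letter order of ★ (B-0).  2026-09-05.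
-/
import Summits.HodgeConjecture.HodgeConjecture.Theorems.R90S1BposBruhatCellsTwoDepth           -- ★-pending p863131 (this seat): `cover_cells_twoDepth` (model)
import Summits.HodgeConjecture.HodgeConjecture.Theorems.K2E3BranchAIrreducibleTwoDepthCells   -- ★ p862990 (K2E3-p34 (g2)): `exists_shellWitness_of_mem_map_of_not_mem` (the letter `hshell`); brings the (G3) frame, ★ `symm_mem_P_of_mem_borelU`, ★ `symm_mem_comap_of_mem`, ★ `symm_mem_N_of_mem_unipotentU`, ★ `map_weyl_eq_weylLongU`
import HarnessLib

/-!
# R90-TF S1 «Ch10-local» ∕ K2 E3 «U4Keys» :182, BRANCH B AT POSITIVE DEPTH — brick (B-2b′), CM half: THE LETTERS `hcells` AND `hwit` OF ★ (B-0)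
# `R90S1BranchBDeterminantVanishingCells.det_intertwiningIntegral_eq_zero_of_typeVector_of_cells` AT `B := J_e` ON `U(Φ₃)(L⁺_v)`
# [Rogawski1990 §1.10; Casselman1995 Prop. 1.3.1, §6.3; BruhatTits1972 (4.4.4), (6.4.9); Roche1998 §3–§4]

Cell `pub/hodgecm-mathlib`, crux H413 = `stmt-HodgeConjecture-24833`, route of record `HCCMUnconditional` (no route verbs); R90-TF section S1 (junction socket A2′ = U4Keys :217,
REL over :155 and :182).  THEOREMS ONLY (no `def`, no `instance`, no `notation`, no named-fact hypothesis, no `sorry`); lane `--supports stmt-HodgeConjecture-24833 --as helper`,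
count-neutral.  NOT THE PAYER of :182.  FRAME = the (G3) frame of ★ p862772 ∕ ★ p862990 verbatim: `(L v) (w hw) (eA heA) (ϖ hϖ)`, exponents `(r₁ s₁ r₂ s₂)`, the model level
group `(Jg hJg)` of ★ D174 and its pull-back `(Je hJe)`, `w₀` the element of matrix `Φ₃` (`hw₀`).

THE POINT.  The generic Branch-B engine ★ (B-0) runs on three letters: a type basis (brick (B-1)), the COVER `hcells : ∀ y, y ∈ P·J_e ∨ y ∈ P·w₀·J_e ∨ ∃ r ∈ R, y ∈ P·r·J_e`,
and the WITNESSES `hwit : ∀ r ∈ R, ∃ b₀ ∈ J_e, ∃ (r b₀ r⁻¹ ∈ P), θ(b₀) ≠ τ(r b₀ r⁻¹)·1`.  Here `R` = the SHELL family: `r ∈ N̄ = N.map (conj w₀)`, `r ∉ J_e`, `eA r` off the sharp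
big cell — EXACTLY the three letters `hr`, `hoff`, `hshal` of ★ p862990.  §1 transports the model cover ★-pending `cover_cells_twoDepth` along `eA` (pattern ★ `cover_borel_I`:
`eA⁻¹P ⊆ P` ★ `symm_mem_P_of_mem_borelU`, `eA⁻¹J_g ⊆ J_e` ★ `symm_mem_comap_of_mem`, `eA⁻¹N ⊆ N` ★ `symm_mem_N_of_mem_unipotentU`, `eA⁻¹w = w₀` ★ `map_weyl_eq_weylLongU`);
§2 is ★ p862990 `exists_shellWitness_of_mem_map_of_not_mem` re-ordered into (B-0)'s `hwit` shape.  Both letters are GENERIC in `(m, k, e)` and in the Branch-A∕B letters —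
no torus witness, no hA, no hB: the Branch-B LEAF (B-7) feeds `(s₁, s₂) = (0, 1)`, `k = 0` and the F-witness `u₂ := ι_vϖ_v` (memo §2 (E5)).
* §1 `symm_mem_map_conj_of_mem_map_conj` (`eA⁻¹` maps `wNw` into `w₀Nw₀⁻¹`), **`cover_cells_twoDepth_CM`** — the letter `hcells`.
* §2 **`shellWitness_family`** — the letter `hwit` (★ p862990).
HONEST LABEL.  HC_CM is proved only modulo the 7 printed citations (2 remaining named inputs: hLiu418 = `stmt-HodgeConjecture-24832`, h413 = `stmt-HodgeConjecture-24833`) until rung 0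
closes; count-neutral — this file does NOT pay :182 or A2′; no printed citation is discharged.

## References
* [Rogawski1990] J. D. Rogawski, *Automorphic Representations of Unitary Groups in Three Variables*, Ann. of Math. Stud. 123 (1990), §1.10 p. 9.
* [Casselman1995] W. Casselman, *Introduction to the theory of admissible representations of `p`-adic reductive groups* (1995), Prop. 1.3.1, §6.3.
* [BruhatTits1972] F. Bruhat, J. Tits, *Groupes réductifs sur un corps local I*, Publ. Math. IHÉS 41 (1972), (4.4.4), (6.4.9).
* [Roche1998] A. Roche, *Types and Hecke algebras for principal series representations of split reductive p-adic groups*, Ann. Sci. ÉNS (4) 31 (1998), §3–§4.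
-/

set_option autoImplicit false
-- the mandated namespace repeats the single-problem summit's segment (`HodgeConjecture.HodgeConjecture`)
set_option linter.dupNamespace false

noncomputable section

open NumberField IsDedekindDomain MeasureTheory
open scoped Matrix MatrixGroups WithZero Valued
open Literature.NumberTheory Literature.NumberTheory.Automorphic Literature.NumberTheory.Automorphic.UnitaryGroup
open Literature.NumberTheory.Rogawski1990

namespace Summit.HodgeConjecture.HodgeConjecture.R90.S1.BposCellCoverTwoDepthCM

open Summit.HodgeConjecture.HodgeConjecture.Cruxes.H413
open Summit.HodgeConjecture.HodgeConjecture.Cruxes.H413.K2E3DepthZeroIwahoriCharacterCM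
open Summit.HodgeConjecture.HodgeConjecture.Cruxes.H413.K2E3BranchALettersCM
open Summit.HodgeConjecture.HodgeConjecture.Cruxes.H413.K2E3LevelNDepthWitnessCM

variable (L : Type) [Field L] [NumberField L] [IsCMField L] (v : HeightOneSpectrum (𝓞 ↥(maximalRealSubfield L)))
  (w : PlacesOver L v) (hw : IsCMField.complexConj L • w.1 = w.1)
  (eA : Gqs L v ≃ₜ* ↥(unitaryGroupOfForm (galAdicCompletionMap (L := L) (IsCMField.complexConj L) hw) ((StdForm.antidiagonal 3).over (w.1.adicCompletion L))))
  (heA : ∀ g : Gqs L v,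
    ((eA g : ↥(unitaryGroupOfForm (galAdicCompletionMap (L := L) (IsCMField.complexConj L) hw) ((StdForm.antidiagonal 3).over (w.1.adicCompletion L)))) :
        GL (Fin 3) (w.1.adicCompletion L)) =
      ((localNonsplitEquiv (IsCMField.complexConj L) (qsForm L) (IsCMField.complexConj_ne_one L) w hw g :
        ↥(unitaryGroupOfForm (galAdicCompletionMap (L := L) (IsCMField.complexConj L) hw) (placeForm (qsForm L) w.1))) : GL (Fin 3) (w.1.adicCompletion L)))
  {ϖ : w.1.adicCompletion L} (hϖ : Valued.v ϖ = WithZero.exp (-1 : ℤ))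
  (r₁ s₁ r₂ s₂ : ℕ) (Jg : Subgroup ↥(unitaryGroupOfForm (galAdicCompletionMap (L := L) (IsCMField.complexConj L) hw) ((StdForm.antidiagonal 3).over (w.1.adicCompletion L))))
  (hJg : ∀ k : ↥(unitaryGroupOfForm (galAdicCompletionMap (L := L) (IsCMField.complexConj L) hw) ((StdForm.antidiagonal 3).over (w.1.adicCompletion L))),
    k ∈ Jg ↔ ∀ i j, Valued.v (((k : GL (Fin 3) (w.1.adicCompletion L)) : Matrix (Fin 3) (Fin 3) (w.1.adicCompletion L)) i j) ≤
      Valued.v ϖ ^ (![![0, r₁, s₁], ![r₂, 0, r₁], ![s₂, r₂, 0]] : Fin 3 → Fin 3 → ℕ) i j)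
  (Je : Subgroup (Gqs L v)) (hJe : Je = Jg.comap eA.toMulEquiv.toMonoidHom)
  (w₀ : Gqs L v) (hw₀ : Units.val (w₀.val : GL (Fin 3) (LocalRing L v)) = cmLocalForm L 3 v)

/-! ## §1 The cover letter `hcells` on `U(Φ₃)(L⁺_v)` -/

include hw heA hw₀ in
/-- `eA⁻¹` maps the model `N̄ = N.map (conj w)` into `N̄(L⁺_v) = N.map (conj w₀)` (`eA⁻¹ N ⊆ N` ★ `symm_mem_N_of_mem_unipotentU`, `eA⁻¹ w = w₀` ★ `map_weyl_eq_weylLongU`).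
[cite: Rogawski1990, §1.10 p. 9] -/
theorem symm_mem_map_conj_of_mem_map_conj
    {nb : ↥(unitaryGroupOfForm (galAdicCompletionMap (L := L) (IsCMField.complexConj L) hw) ((StdForm.antidiagonal 3).over (w.1.adicCompletion L)))}
    (hnb : nb ∈ ((borelTriple (galAdicCompletionMap (L := L) (IsCMField.complexConj L) hw) ((StdForm.antidiagonal 3).over (w.1.adicCompletion L)) rfl).N).map
      (MulAut.conj (weylLongU (galAdicCompletionMap (L := L) (IsCMField.complexConj L) hw) (rfl : (StdForm.antidiagonal 3).over (w.1.adicCompletion L) = _))).toMonoidHom) :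
    eA.symm nb ∈ ((cmBorelTriple L 3 v).N).map (MulAut.conj w₀).toMonoidHom := by
  obtain ⟨n, hn, rfl⟩ := Subgroup.mem_map.1 hnb
  have hwL := map_weyl_eq_weylLongU L v w hw eA heA w₀ hw₀
  refine Subgroup.mem_map.2 ⟨eA.symm n, symm_mem_N_of_mem_unipotentU L v w hw eA heA hn, ?_⟩
  apply eA.injective
  rw [MulEquiv.coe_toMonoidHom, MulAut.conj_apply, MulEquiv.coe_toMonoidHom, MulAut.conj_apply, map_mul, map_mul, map_inv,
    ContinuousMulEquiv.apply_symm_apply, ContinuousMulEquiv.apply_symm_apply, hwL]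

include hw heA hϖ hJg hJe hw₀ in
/-- **THE LETTER `hcells` OF ★ (B-0) AT `B := J_e` ON `U(Φ₃)(L⁺_v)`.**  Every `y ∈ U(Φ₃)(L⁺_v)` lies in `P·J_e`, in `P·w₀·J_e`, or in `P·r·J_e` for a SHELL representative
`r ∈ R := {r ∈ N̄(L⁺_v) : r ∉ J_e ∧ eA r off the sharp big cell}` (the letters `hr`, `hoff`, `hshal` of ★ p862990, verbatim): ★-pending `cover_cells_twoDepth` on `eA y`, pulled
back along `eA`. [cite: Rogawski1990, §1.10 p. 9] [cite: Casselman1995, Prop. 1.3.1, §6.3] [cite: BruhatTits1972, (4.4.4), (6.4.9)] [cite: Roche1998, §3–§4] -/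
theorem cover_cells_twoDepth_CM (t : ParabolicTriple (Gqs L v)) (ht : t = cmBorelTriple L 3 v) :
    ∀ y : ↥(unitaryGroupOfForm (conjLocal L (IsCMField.complexConj L) v) (cmLocalForm L 3 v)),
      (∃ h ∈ t.P, ∃ b ∈ Je, y = h * b) ∨
      (∃ h ∈ t.P, ∃ b ∈ Je, y = h * w₀ * b) ∨
      ∃ r ∈ {r : Gqs L v | r ∈ ((cmBorelTriple L 3 v).N).map (MulAut.conj w₀).toMonoidHom ∧ r ∉ Je ∧
          ¬ (Valued.v ((((eA r : ↥(unitaryGroupOfForm (galAdicCompletionMap (L := L) (IsCMField.complexConj L) hw) ((StdForm.antidiagonal 3).over (w.1.adicCompletion L)))) :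
                GL (Fin 3) (w.1.adicCompletion L)) : Matrix (Fin 3) (Fin 3) (w.1.adicCompletion L)) 2 1 /
              (((eA r : ↥(unitaryGroupOfForm (galAdicCompletionMap (L := L) (IsCMField.complexConj L) hw) ((StdForm.antidiagonal 3).over (w.1.adicCompletion L)))) :
                GL (Fin 3) (w.1.adicCompletion L)) : Matrix (Fin 3) (Fin 3) (w.1.adicCompletion L)) 2 0) ≤ Valued.v ϖ ^ r₁ ∧
            (Valued.v ϖ ^ s₁)⁻¹ ≤ Valued.v ((((eA r : ↥(unitaryGroupOfForm (galAdicCompletionMap (L := L) (IsCMField.complexConj L) hw)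
                ((StdForm.antidiagonal 3).over (w.1.adicCompletion L)))) : GL (Fin 3) (w.1.adicCompletion L)) : Matrix (Fin 3) (Fin 3) (w.1.adicCompletion L)) 2 0))},
        ∃ h ∈ t.P, ∃ b ∈ Je, y = h * r * b := by
  intro y
  have hσσ : ∀ x, (galAdicCompletionMap (L := L) (IsCMField.complexConj L) hw) ((galAdicCompletionMap (L := L) (IsCMField.complexConj L) hw) x) = x :=
    galAdicCompletionMap_galAdicCompletionMap_of_smul_eq (IsCMField.complexConj L) w (IsCMField.complexConj_ne_one L) hw
  have hvσ : ∀ x, Valued.v (galAdicCompletionMap (L := L) (IsCMField.complexConj L) hw x) = Valued.v x :=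
    fun x => valued_galAdicCompletionMap (L := L) (IsCMField.complexConj L) hw x
  have he0 : ∀ i : Fin 3, (![![0, r₁, s₁], ![r₂, 0, r₁], ![s₂, r₂, 0]] : Fin 3 → Fin 3 → ℕ) i i = 0 := fun i => by
    fin_cases i <;> rfl
  have hwL := map_weyl_eq_weylLongU L v w hw eA heA w₀ hw₀
  rcases BposBruhatCellsTwoDepth.cover_cells_twoDepth (galAdicCompletionMap (L := L) (IsCMField.complexConj L) hw)
      (rfl : (StdForm.antidiagonal 3).over (w.1.adicCompletion L) = _) hσσ hvσ hϖ _ Jg hJg he0 (K2E3IwahoriTwoDepthFactorisation.twoDepth_symm r₁ s₁ r₂ s₂) (eA y)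
    with ⟨h, hh, b, hb, hy⟩ | ⟨h, hh, b, hb, hy⟩ | ⟨r, ⟨hrN, hroff, hrshal⟩, h, hh, b, hb, hy⟩
  · refine Or.inl ⟨eA.symm h, symm_mem_P_of_mem_borelU L v w hw eA heA t ht hh, eA.symm b,
      K2E3LowerUnipotentDeepCellCM.symm_mem_comap_of_mem L v w hw eA Jg Je hJe hb, ?_⟩
    apply eA.injective
    rw [hy, map_mul, ContinuousMulEquiv.apply_symm_apply, ContinuousMulEquiv.apply_symm_apply]
  · refine Or.inr (Or.inl ⟨eA.symm h, symm_mem_P_of_mem_borelU L v w hw eA heA t ht hh, eA.symm b,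
      K2E3LowerUnipotentDeepCellCM.symm_mem_comap_of_mem L v w hw eA Jg Je hJe hb, ?_⟩)
    apply eA.injective
    rw [hy, map_mul, map_mul, ContinuousMulEquiv.apply_symm_apply, ContinuousMulEquiv.apply_symm_apply, hwL]
  · refine Or.inr (Or.inr ⟨eA.symm r, ⟨symm_mem_map_conj_of_mem_map_conj L v w hw eA heA w₀ hw₀ hrN, ?_, ?_⟩, eA.symm h,
      symm_mem_P_of_mem_borelU L v w hw eA heA t ht hh, eA.symm b, K2E3LowerUnipotentDeepCellCM.symm_mem_comap_of_mem L v w hw eA Jg Je hJe hb, ?_⟩)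
    · -- `eA⁻¹ r ∉ J_e`
      intro hmem
      apply hroff
      subst hJe
      have h1 : eA (eA.symm r) ∈ Jg := hmem
      rwa [ContinuousMulEquiv.apply_symm_apply] at h1
    · -- off the sharp big cell
      rw [ContinuousMulEquiv.apply_symm_apply]
      exact hrshal
    · apply eA.injective
      rw [hy, map_mul, map_mul, ContinuousMulEquiv.apply_symm_apply, ContinuousMulEquiv.apply_symm_apply, ContinuousMulEquiv.apply_symm_apply]

/-! ## §2 The witness letter `hwit` on the shell family (★ p862990 re-ordered) -/

open Classical in
include hw heA hϖ hJg hJe hw₀ in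
set_option maxHeartbeats 1600000 in
-- class of ★ p862990 (the same carrier-unification cost)
/-- **THE LETTER `hwit` OF ★ (B-0) ON THE SHELL FAMILY `R`** (CM): for every `r ∈ R` (= `r ∈ N̄(L⁺_v)`, `r ∉ J_e`, `eA r` off the sharp big cell) there is `b₀ ∈ J_e` with
`r b₀ r⁻¹ ∈ P` and `θ(b₀) ≠ τ(r b₀ r⁻¹)·1` — ★ p862990 `exists_shellWitness_of_mem_map_of_not_mem` verbatim (letters `hm hkm hrr hss hr1 hr2 hs1 hs2 hal h10 h20 ht hvt hcond u₁ hu₁ hχu₁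
u₂ hσu₂ hu₂ hχu₂`), re-ordered into the shape `∃ b₀ ∈ B, ∃ hb₀H, θ b₀ ≠ τ ⟨r b₀ r⁻¹, hb₀H⟩ 1` consumed by ★ (B-0) and ★ p861573. [cite: Roche1998, §3–§4] [cite: Casselman1995, §6.3]
[cite: BruhatTits1972, (6.4.9)] [cite: Rogawski1990, §12.1 p. 171] -/
theorem shellWitness_family {m k : ℕ} (hm : 1 ≤ m) (hkm : k ≤ m) (hrr : r₁ + r₂ = m + 1) (hss : s₁ + s₂ = k + 1)
    (hr1 : r₁ ≤ r₂ + 1) (hr2 : r₂ ≤ r₁ + 1) (hs1 : s₁ ≤ s₂ + 1) (hs2 : s₂ ≤ s₁ + 1) (hal : (r₁ ≤ r₂ ∧ s₁ ≤ s₂) ∨ (r₂ ≤ r₁ ∧ s₂ ≤ s₁))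
    (h10 : 1 ≤ r₂) (h20 : 1 ≤ s₂)
    {t : w.1.adicCompletion L} (ht : t + galAdicCompletionMap (L := L) (IsCMField.complexConj L) hw t = 1) (hvt : Valued.v t ≤ 1)
    (χ₁ : (LocalRing L v)ˣ →* ℂˣ)
    (hcond : ∀ u : (LocalRing L v)ˣ, (∀ w' : PlacesOver L v, Valued.v (((u : LocalRing L v) w') - 1) ≤ Valued.v ϖ ^ (m + 1)) → χ₁ u = 1)
    (u₁ : (LocalRing L v)ˣ) (hu₁ : ∀ w' : PlacesOver L v, Valued.v (((u₁ : LocalRing L v) w') - 1) ≤ Valued.v ϖ ^ m) (hχu₁ : χ₁ u₁ ≠ 1)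
    (u₂ : (LocalRing L v)ˣ) (hσu₂ : Units.map (conjLocal L (IsCMField.complexConj L) v : LocalRing L v →* LocalRing L v) u₂ = u₂)
    (hu₂ : ∀ w' : PlacesOver L v, Valued.v (((u₂ : LocalRing L v) w') - 1) ≤ Valued.v ϖ ^ k) (hχu₂ : χ₁ u₂ ≠ 1) :
    ∀ r ∈ {r : Gqs L v | r ∈ ((cmBorelTriple L 3 v).N).map (MulAut.conj w₀).toMonoidHom ∧ r ∉ Je ∧
          ¬ (Valued.v ((((eA r : ↥(unitaryGroupOfForm (galAdicCompletionMap (L := L) (IsCMField.complexConj L) hw) ((StdForm.antidiagonal 3).over (w.1.adicCompletion L)))) :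
                GL (Fin 3) (w.1.adicCompletion L)) : Matrix (Fin 3) (Fin 3) (w.1.adicCompletion L)) 2 1 /
              (((eA r : ↥(unitaryGroupOfForm (galAdicCompletionMap (L := L) (IsCMField.complexConj L) hw) ((StdForm.antidiagonal 3).over (w.1.adicCompletion L)))) :
                GL (Fin 3) (w.1.adicCompletion L)) : Matrix (Fin 3) (Fin 3) (w.1.adicCompletion L)) 2 0) ≤ Valued.v ϖ ^ r₁ ∧
            (Valued.v ϖ ^ s₁)⁻¹ ≤ Valued.v ((((eA r : ↥(unitaryGroupOfForm (galAdicCompletionMap (L := L) (IsCMField.complexConj L) hw)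
                ((StdForm.antidiagonal 3).over (w.1.adicCompletion L)))) : GL (Fin 3) (w.1.adicCompletion L)) : Matrix (Fin 3) (Fin 3) (w.1.adicCompletion L)) 2 0))},
      ∃ b₀ ∈ Je, ∃ hb₀P : ((r * b₀ * r⁻¹ : Gqs L v) : ↥(unitaryGroupOfForm (conjLocal L (IsCMField.complexConj L) v) (cmLocalForm L 3 v))) ∈ (cmBorelTriple L 3 v).P,
        (if h : IsUnit (((b₀.val : GL (Fin 3) (LocalRing L v)) : Matrix (Fin 3) (Fin 3) (LocalRing L v)) 0 0) then ((χ₁ h.unit : ℂˣ) : ℂ) else 0) ≠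
          (haveI := locallyCompactSpace_cmBorelU L 3 v
           (Representation.twist
              (((Representation.trivial ℂ ↥(torusU (conjLocal L (IsCMField.complexConj L) v) (cmLocalForm L 3 v)) ℂ).twist
                (cmTorusCharPair L v χ₁ 1)).comp (cmBorelTriple L 3 v).proj) (rootDeltaChar (cmBorelTriple L 3 v).P))
            ⟨((r * b₀ * r⁻¹ : Gqs L v) : ↥(unitaryGroupOfForm (conjLocal L (IsCMField.complexConj L) v) (cmLocalForm L 3 v))), hb₀P⟩ 1) := by
  rintro r ⟨hr, hoff, hshal⟩
  obtain ⟨b₀, hb₀P, hb₀, hne⟩ := K2E3BranchAIrreducibleTwoDepthCells.exists_shellWitness_of_mem_map_of_not_mem L v w hw eA heA hϖ r₁ s₁ r₂ s₂ Jg hJg Je hJe w₀ hw₀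
    hm hkm hrr hss hr1 hr2 hs1 hs2 hal h10 h20 ht hvt χ₁ hcond u₁ hu₁ hχu₁ u₂ hσu₂ hu₂ hχu₂ hr hoff hshal
  exact ⟨b₀, hb₀, hb₀P, hne⟩

end Summit.HodgeConjecture.HodgeConjecture.R90.S1.BposCellCoverTwoDepthCM

end
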